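import Mathlib
import HarnessLib
import Summits.KontsevichZagierPeriods.Zeta5Search.TwoTaleWhippleRemark5
import Summits.KontsevichZagierPeriods.Zeta5Search.TwoTaleWhippleRemark5Terms
import Summits.KontsevichZagierPeriods.Zeta5Search.SorokinCensus.TopPoleLaw

/-!
# TwoTaleWhippleRemark5Full — Zudilin's Remark 5 (Whipple) for ALL admissible data: the node `WhippleRemark5`

HONEST FRAMING: systematic search; no irrationality claim unless certified.  Identities between FINITE binomial
sums (a terminating hypergeometric transformation read on typed closed forms); nothing about the arithmetic of
`ζ(2)` or `ζ(5)`, no measure, no number of the cell's `μ(ζ(2))` ladder moves; 0 kit.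

Cell pub-zeta5, seat ct-1 g26 (cross-lineage discharge for the measure lineage, lead ruling INBOX l.9151).
Zudilin [Zudilin2014ZetaTwo, Remark 5] reads Whipple's transformation of a terminating nearly-poised `₄F₃(1)` into a
Saalschützian `₅F₄(1)` [Slater (2.4.2.3); Whipple 1926 §3.5; Bailey 1935 §4.5] as the identity
`q(a₁,a₂,a₃,a₄; 1, a₄−a₁+1, a₄−a₂+1, b₄) = −q̂(b₄−a₃+a₄; a₂, a₁, a₄; a₄+1; a₄−a₃+1, a₁+a₂, b₄)` between the
`ζ(2)`-coefficients of his two hypergeometric tales (typed: `Zudilin2014.formQZ`, `Zudilin2014.formQTZ`; the sign is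
the one the typed closed forms produce).  The tree had it on the CONE `a₁, a₂, a₃ ≤ a₄` only
(`TwoTaleWhippleRemark5.remark5Max`, `TwoTaleWhippleDischarged.whippleRemark5Max_holds`), which suffices for both
kernel rungs; the node `TwoTaleWhipple.WhippleRemark5` (ALL first-tale-admissible data) stayed `@[conjecture]`.  Off
the cone — most admissible data — `a₄−a₁`, `a₄−a₂` or `a₄−a₃` is negative and the natural-number bookkeeping of the
cone proof does not apply.

THIS FILE proves the node with NO cone hypothesis (`whippleRemark5_holds`) by the UNIFORM k-centric route of
`TwoTaleWhippleRemark5Terms` (no case split on signs): with the pole index `k` and `F = (b₄−a₁−1)!(b₄−a₂−1)!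
(b₄−a₃−1)!·e!·e'!`,

* `first_term` (E1): `(a₄−1)!(a₂−1)!·nearlyPoisedTerm(k−a₄) = (−1)^{(a₁−1)+e+e'}·F·C_k` on `[max aᵢ, b₄)`; below
  `max aᵢ` both sides vanish (`coefCZ_eq_zero` + the `npt` vanishing lemmas); summed: `sum_first`;
* `second_term` (E2): `(a₄−1)!(a₂−1)!·saalschutzianTerm(k−a₄) = (−1)^N·F·((−1)^{(b₄−a₃−1)+e'+(k−a₁)+(k−a₄)}·A_k)` on
  `[â₃*, b̂₂*)` off the guard `2k < â₀` (= the vanishing of `(−t)_m`); the term vanishes on the rest of `[a₄, b₄)`;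
  summed: `sum_second`;
* `remark5`: Whipple's (W) over `ℤ` (`HypergeometricWhipple.whipple_nearlyPoised_terms`), cancellation of the non-zero
  factor `F·(±1)` and the parity `((a₁−1)+e+e'+d) − (N+(b₄−a₃−1)+e'+(a₁+a₄)+|a₁+a₂+b₄|) ≡ 1 (mod 2)` give
  `formQZ = −formQTZ`; `whippleRemark5_holds : WhippleRemark5`.

Exact check before filing (`HOME/ct-1/g26/code/remark5_full_check.py`, stdlib, 2 CPU-s; mirrors the Lean definitions of
`formQZ`/`formQTZ` with `Ring.choose` and the `toNat` guards): all 14 161 admissible Remark-5 data with `aᵢ ≤ 7`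
(12 615 of them off the cone) satisfy Remark 5, and every termwise instance of (E1)/(E2) with the constants above and
the vanishing lemmas holds at every `k` — 0 failures.  The hypothesis-free forms of the node's consumers are ALREADY
in the tree from the cone (`TwoTaleWhippleDischarged`); none is restated here.  Theorems only (no new definitions).
-/

namespace Summit.KontsevichZagierPeriods.Zeta5Search.TwoTaleWhippleRemark5Full

open Finset Nat
open Summit.KontsevichZagierPeriods.Zeta5Search.HypergeometricWhipple
open Summit.KontsevichZagierPeriods.Zeta5Search.TwoTaleWhippleRemark5Terms

/-! ### The dictionary at Remark-5 data -/

section data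

open Literature.NumberTheory.Irrationality.Zudilin2014
open Summit.KontsevichZagierPeriods.Zeta5Search.TwoTaleWhipple (firstA firstB hatA hatB)
open Summit.KontsevichZagierPeriods.Zeta5Search.TwoTaleWhippleRemark5 (sum_Ico_int_eq_sum_range zb_neg_of_le)

variable {a₁ a₂ a₃ a₄ b₄ : ℤ}

/-- The linear inequalities of first-tale admissibility at Remark-5 data. -/
theorem bounds (hadm : Admissible (firstA a₁ a₂ a₃ a₄) (firstB a₁ a₂ a₄ b₄)) :
    1 ≤ a₁ ∧ 1 ≤ a₂ ∧ 1 ≤ a₃ ∧ 1 ≤ a₄ ∧ a₄ + 1 ≤ a₁ + a₂ ∧ a₄ + 1 ≤ a₂ + a₃ ∧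
      a₁ < b₄ ∧ a₂ < b₄ ∧ a₃ < b₄ ∧ a₄ < b₄ ∧ b₄ + a₄ + 3 ≤ 2 * a₁ + 2 * a₂ + a₃ := by
  have l00 := hadm.lower 0 (by decide) 0
  have l01 := hadm.lower 0 (by decide) 1
  have l02 := hadm.lower 0 (by decide) 2
  have l03 := hadm.lower 0 (by decide) 3
  have l11 := hadm.lower 1 (by decide) 1
  have l22 := hadm.lower 2 (by decide) 2
  have u0 := hadm.upper 0
  have u1 := hadm.upper 1
  have u2 := hadm.upper 2
  have u3 := hadm.upper 3
  have hbal := hadm.balance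
  simp only [TwoTaleWhipple.firstA_zero, TwoTaleWhipple.firstA_one, TwoTaleWhipple.firstA_two,
    TwoTaleWhipple.firstA_three, TwoTaleWhipple.firstB_zero, TwoTaleWhipple.firstB_one,
    TwoTaleWhipple.firstB_two, TwoTaleWhipple.firstB_three, Fin.sum_univ_four] at l00 l01 l02 l03 l11 l22 u0 u1 u2 u3 hbal
  omega

/-- **(E1) at the data**: on the pole range `max aᵢ ≤ k < b₄`,
`(a₄−1)!·(a₂−1)!·nearlyPoisedTerm(a₄, a₄−a₁+1, a₄−a₁−a₂+1, a₄−a₃+1; N; k−a₄)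
 = (−1)^{(a₁−1)+e+e'}·(b₄−a₁−1)!(b₄−a₂−1)!(b₄−a₃−1)!·e!·e'!·C_k`. -/
theorem first_term (hadm : Admissible (firstA a₁ a₂ a₃ a₄) (firstB a₁ a₂ a₄ b₄)) {k : ℤ}
    (hk1 : a₁ ≤ k) (hk2 : a₂ ≤ k) (hk3 : a₃ ≤ k) (hk4 : a₄ ≤ k) (hkb : k < b₄) :
    ((a₄ - 1).toNat ! : ℤ) * ((a₂ - 1).toNat ! : ℤ) *
        nearlyPoisedTerm a₄ (a₄ - a₁ + 1) (a₄ - a₁ - a₂ + 1) (a₄ - a₃ + 1) (b₄ - a₄ - 1).toNat (k - a₄).toNat =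
      (-1) ^ ((a₁ - 1).toNat + (a₁ + a₂ - a₄ - 1).toNat + (a₂ + a₃ - a₄ - 1).toNat) *
        (((b₄ - a₁ - 1).toNat ! : ℤ) * ((b₄ - a₂ - 1).toNat ! : ℤ) * ((b₄ - a₃ - 1).toNat ! : ℤ) *
          ((a₁ + a₂ - a₄ - 1).toNat ! : ℤ) * ((a₂ + a₃ - a₄ - 1).toNat ! : ℤ)) *
        coefCZ (firstA a₁ a₂ a₃ a₄) (firstB a₁ a₂ a₄ b₄) k := by
  obtain ⟨l00, l01, l02, l03, hE, hE', u0, u1, u2, u3, -⟩ := bounds hadm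
  -- natural coordinates
  have hcore := core_first (a₁ - 1).toNat (a₂ - 1).toNat (a₄ - 1).toNat (a₁ + a₂ - a₄ - 1).toNat
    (a₂ + a₃ - a₄ - 1).toNat (k - a₄).toNat (b₄ - 1 - k).toNat (k - a₁).toNat (k - a₂).toNat (k - a₃).toNat
    (by omega) (by omega) (by omega) (by omega)
  have r1 : (((a₄ - 1).toNat : ℕ) : ℤ) + 1 = a₄ := by omega
  have r2 : a₄ - a₁ + 1 = (((k - a₁).toNat : ℕ) : ℤ) - ((k - a₄).toNat : ℕ) + 1 := by omega
  have r3 : a₄ - a₁ - a₂ + 1 = -(((a₁ + a₂ - a₄ - 1).toNat : ℕ) : ℤ) := by omega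
  have r4 : a₄ - a₃ + 1 = (((k - a₃).toNat : ℕ) : ℤ) - ((k - a₄).toNat : ℕ) + 1 := by omega
  have r5 : (b₄ - a₄ - 1).toNat = (k - a₄).toNat + (b₄ - 1 - k).toNat := by omega
  have r6 : (k - a₁).toNat + (b₄ - 1 - k).toNat = (b₄ - a₁ - 1).toNat := by omega
  have r7 : (k - a₂).toNat + (b₄ - 1 - k).toNat = (b₄ - a₂ - 1).toNat := by omega
  have r8 : (k - a₃).toNat + (b₄ - 1 - k).toNat = (b₄ - a₃ - 1).toNat := by omega
  -- the first-tale coefficient in natural coordinates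
  have hC : coefCZ (firstA a₁ a₂ a₃ a₄) (firstB a₁ a₂ a₄ b₄) k =
      (-1) ^ (k - a₄).toNat * ((((k - a₄).toNat + (b₄ - 1 - k).toNat).choose (k - a₄).toNat : ℕ) : ℤ) *
        ((-1) ^ (a₁ - 1).toNat * ((((a₄ - 1).toNat + (k - a₄).toNat).choose (a₁ - 1).toNat : ℕ) : ℤ)) *
        ((-1) ^ (a₁ + a₂ - a₄ - 1).toNat *
          ((((a₁ - 1).toNat + (k - a₄).toNat).choose (a₁ + a₂ - a₄ - 1).toNat : ℕ) : ℤ)) *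
        ((-1) ^ (a₂ + a₃ - a₄ - 1).toNat *
          ((((a₂ - 1).toNat + (k - a₄).toNat).choose (a₂ + a₃ - a₄ - 1).toNat : ℕ) : ℤ)) := by
    unfold coefCZ epsZ zR1
    simp only [TwoTaleWhipple.firstA_zero, TwoTaleWhipple.firstA_one, TwoTaleWhipple.firstA_two,
      TwoTaleWhipple.firstA_three, TwoTaleWhipple.firstB_zero, TwoTaleWhipple.firstB_one,
      TwoTaleWhipple.firstB_two, TwoTaleWhipple.firstB_three]
    rw [zb_neg_of_le 1 a₁ k (by omega) (by omega), zb_neg_of_le (a₄ - a₁ + 1) a₂ k (by omega) (by omega),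
      zb_neg_of_le (a₄ - a₂ + 1) a₃ k (by omega) (by omega)]
    have t1 : (b₄ - a₄ - 1).toNat = (k - a₄).toNat + (b₄ - 1 - k).toNat := by omega
    have t2 : (k - 1).toNat = (a₄ - 1).toNat + (k - a₄).toNat := by omega
    have t3 : (a₂ - (a₄ - a₁ + 1)).toNat = (a₁ + a₂ - a₄ - 1).toNat := by omega
    have t4 : (k - (a₄ - a₁ + 1)).toNat = (a₁ - 1).toNat + (k - a₄).toNat := by omega
    have t5 : (a₃ - (a₄ - a₂ + 1)).toNat = (a₂ + a₃ - a₄ - 1).toNat := by omega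
    have t6 : (k - (a₄ - a₂ + 1)).toNat = (a₂ - 1).toNat + (k - a₄).toNat := by omega
    rw [t1, t2, t3, t4, t5, t6]
    ring
  rw [r1] at hcore
  rw [r2, r3, r4, r5, hC, hcore, r6, r7, r8]

/-- **(E2) at the data**: on `max(a₁,a₂,a₄) ≤ k < min(a₁+a₂, b₄)` with `2k ≥ â₀ = b₄−a₃+a₄`,
`(a₄−1)!·(a₂−1)!·saalschutzianTerm(a₄, a₄−a₁+1, a₄−a₁−a₂+1, a₄−a₃+1; N; k−a₄)
 = (−1)^N·(b₄−a₁−1)!(b₄−a₂−1)!(b₄−a₃−1)!·e!·e'!·((−1)^{(b₄−a₃−1) + e' + (k−a₁) + (k−a₄)}·A_k)`. -/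
theorem second_term (hadm : Admissible (firstA a₁ a₂ a₃ a₄) (firstB a₁ a₂ a₄ b₄)) {k : ℤ}
    (hk1 : a₁ ≤ k) (hk2 : a₂ ≤ k) (hk4 : a₄ ≤ k) (hkb : k < b₄) (hk12 : k < a₁ + a₂)
    (hg : ¬ 2 * k < b₄ - a₃ + a₄) :
    ((a₄ - 1).toNat ! : ℤ) * ((a₂ - 1).toNat ! : ℤ) *
        saalschutzianTerm a₄ (a₄ - a₁ + 1) (a₄ - a₁ - a₂ + 1) (a₄ - a₃ + 1) (b₄ - a₄ - 1).toNat (k - a₄).toNat =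
      (-1) ^ (b₄ - a₄ - 1).toNat *
        (((b₄ - a₁ - 1).toNat ! : ℤ) * ((b₄ - a₂ - 1).toNat ! : ℤ) * ((b₄ - a₃ - 1).toNat ! : ℤ) *
          ((a₁ + a₂ - a₄ - 1).toNat ! : ℤ) * ((a₂ + a₃ - a₄ - 1).toNat ! : ℤ)) *
        ((-1) ^ ((b₄ - a₃ - 1).toNat + (a₂ + a₃ - a₄ - 1).toNat + (k - a₁).toNat + (k - a₄).toNat) *
          coefATZ (hatA a₁ a₂ a₃ a₄ b₄) (hatB a₁ a₂ a₃ a₄ b₄) k) := by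
  obtain ⟨l00, l01, l02, l03, hE, hE', u0, u1, u2, u3, -⟩ := bounds hadm
  have hcore := core_second (a₂ - 1).toNat (a₄ - 1).toNat (a₁ + a₂ - a₄ - 1).toNat (a₂ + a₃ - a₄ - 1).toNat
    (b₄ - a₃ - 1).toNat (k - a₄).toNat (b₄ - 1 - k).toNat (k - a₁).toNat (k - a₂).toNat (k + a₃ - a₄ - 1).toNat
    (2 * k - b₄ + a₃ - a₄).toNat (a₁ + a₂ - 1 - k).toNat
    (by omega) (by omega) (by omega) (by omega) (by omega) (by omega)
  have r1 : (((a₄ - 1).toNat : ℕ) : ℤ) + 1 = a₄ := by omega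
  have r2 : a₄ - a₁ + 1 = (((k - a₁).toNat : ℕ) : ℤ) - ((k - a₄).toNat : ℕ) + 1 := by omega
  have r3 : a₄ - a₁ - a₂ + 1 = -(((a₁ + a₂ - a₄ - 1).toNat : ℕ) : ℤ) := by omega
  have r4 : a₄ - a₃ + 1 = a₄ + ((k - a₄).toNat : ℕ) - ((k + a₃ - a₄ - 1).toNat : ℕ) := by omega
  have r5 : (b₄ - a₄ - 1).toNat = (k - a₄).toNat + (b₄ - 1 - k).toNat := by omega
  have r6 : (k - a₁).toNat + (b₄ - 1 - k).toNat = (b₄ - a₁ - 1).toNat := by omega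
  have r7 : (k - a₂).toNat + (b₄ - 1 - k).toNat = (b₄ - a₂ - 1).toNat := by omega
  -- the second-tale coefficient in natural coordinates
  have hA : coefATZ (hatA a₁ a₂ a₃ a₄ b₄) (hatB a₁ a₂ a₃ a₄ b₄) k =
      (-1) ^ ((b₄ - a₃ - 1).toNat + (a₂ + a₃ - a₄ - 1).toNat + (k - a₁).toNat + (k - a₄).toNat) *
        (((((a₄ - 1).toNat + 2 * (k - a₄).toNat).choose (b₄ - a₃ - 1).toNat : ℕ) : ℤ) *
          (((k + a₃ - a₄ - 1).toNat.choose (a₂ + a₃ - a₄ - 1).toNat : ℕ) : ℤ) *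
          (((a₂ - 1).toNat.choose (k - a₁).toNat : ℕ) : ℤ) *
          ((((k - a₄).toNat + (b₄ - 1 - k).toNat).choose (k - a₄).toNat : ℕ) : ℤ)) := by
    unfold coefATZ
    simp only [TwoTaleWhipple.hatA_zero, TwoTaleWhipple.hatA_one, TwoTaleWhipple.hatA_two,
      TwoTaleWhipple.hatA_three, TwoTaleWhipple.hatB_zero, TwoTaleWhipple.hatB_one, TwoTaleWhipple.hatB_two,
      TwoTaleWhipple.hatB_three]
    rw [if_neg hg]
    have t1 : (2 * k - (a₄ + 1)).toNat = (a₄ - 1).toNat + 2 * (k - a₄).toNat := by omega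
    have t2 : (b₄ - a₃ + a₄ - (a₄ + 1)).toNat = (b₄ - a₃ - 1).toNat := by omega
    have t3 : (k - (a₄ - a₃ + 1)).toNat = (k + a₃ - a₄ - 1).toNat := by omega
    have t4 : (a₂ - (a₄ - a₃ + 1)).toNat = (a₂ + a₃ - a₄ - 1).toNat := by omega
    have t5 : (a₁ + a₂ - a₁ - 1).toNat = (a₂ - 1).toNat := by omega
    have t6 : (b₄ - a₄ - 1).toNat = (k - a₄).toNat + (b₄ - 1 - k).toNat := by omega
    rw [t1, t2, t3, t4, t5, t6]
    ring
  have hA' : (-1) ^ ((b₄ - a₃ - 1).toNat + (a₂ + a₃ - a₄ - 1).toNat + (k - a₁).toNat + (k - a₄).toNat) *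
      coefATZ (hatA a₁ a₂ a₃ a₄ b₄) (hatB a₁ a₂ a₃ a₄ b₄) k =
      ((((a₄ - 1).toNat + 2 * (k - a₄).toNat).choose (b₄ - a₃ - 1).toNat : ℕ) : ℤ) *
          (((k + a₃ - a₄ - 1).toNat.choose (a₂ + a₃ - a₄ - 1).toNat : ℕ) : ℤ) *
          (((a₂ - 1).toNat.choose (k - a₁).toNat : ℕ) : ℤ) *
          ((((k - a₄).toNat + (b₄ - 1 - k).toNat).choose (k - a₄).toNat : ℕ) : ℤ) := by
    rw [hA, ← mul_assoc, ← pow_add, ← two_mul, pow_mul, neg_one_sq, one_pow, one_mul]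
  rw [r1] at hcore
  rw [r2, r3, r4, r5, hA', hcore, r6, r7]

end data

/-! ### Summation over the pole ranges -/

section sums

open Literature.NumberTheory.Irrationality.Zudilin2014
open Summit.KontsevichZagierPeriods.Zeta5Search.TwoTaleWhipple (firstA firstB hatA hatB WhippleRemark5)
open Summit.KontsevichZagierPeriods.Zeta5Search.TwoTaleWhippleRemark5 (sum_Ico_int_eq_sum_range)

variable {a₁ a₂ a₃ a₄ b₄ : ℤ}

/-- A numerator block of `R₁` vanishes at a pole `t = −k` lying inside it: `zb lo hi (−k) = 0` for `lo ≤ k < hi`. -/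
theorem zb_neg_eq_zero (lo hi k : ℤ) (hlo : lo ≤ k) (hk : k < hi) : zb lo hi (-k) = 0 := by
  unfold zb
  rw [show -k + hi - 1 = (((hi - 1 - k).toNat : ℕ) : ℤ) by omega, Ring.choose_natCast]
  exact_mod_cast Nat.choose_eq_zero_of_lt (by omega)

/-- `C_k = 0` at a pole index below `max aᵢ` (some numerator block of `R₁` vanishes there). -/
theorem coefCZ_eq_zero (hadm : Admissible (firstA a₁ a₂ a₃ a₄) (firstB a₁ a₂ a₄ b₄)) {k : ℤ} (hk4 : a₄ ≤ k)
    (hk : k < a₁ ∨ k < a₂ ∨ k < a₃) : coefCZ (firstA a₁ a₂ a₃ a₄) (firstB a₁ a₂ a₄ b₄) k = 0 := by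
  obtain ⟨l00, l01, l02, l03, hE, hE', -⟩ := bounds hadm
  unfold coefCZ zR1
  simp only [TwoTaleWhipple.firstA_zero, TwoTaleWhipple.firstA_one, TwoTaleWhipple.firstA_two,
    TwoTaleWhipple.firstB_zero, TwoTaleWhipple.firstB_one, TwoTaleWhipple.firstB_two]
  rcases hk with h1 | h2 | h3
  · rw [zb_neg_eq_zero 1 a₁ k (by omega) h1]; ring
  · rw [zb_neg_eq_zero (a₄ - a₁ + 1) a₂ k (by omega) h2]; ring
  · rw [zb_neg_eq_zero (a₄ - a₂ + 1) a₃ k (by omega) h3]; ring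

/-- A `range` sum re-indexed over the pole interval `[a₄, b₄)`. -/
theorem sum_range_eq_sum_Ico (hab : a₄ < b₄) (F : ℕ → ℤ) :
    ∑ n ∈ range ((b₄ - a₄ - 1).toNat + 1), F n = ∑ k ∈ Ico a₄ b₄, F (k - a₄).toNat := by
  rw [show Ico a₄ b₄ = Ico a₄ (a₄ + ((((b₄ - a₄ - 1).toNat + 1 : ℕ)) : ℤ)) by congr 1; omega,
    sum_Ico_int_eq_sum_range]
  exact Finset.sum_congr rfl fun n _ => by congr 1; omega

/-- **First tale summed**: `(a₄−1)!(a₂−1)! · Σ_n nearlyPoisedTerm = (−1)^{(a₁−1)+e+e'}·F·Σ_{k ≥ max aᵢ} C_k`. -/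
theorem sum_first (hadm : Admissible (firstA a₁ a₂ a₃ a₄) (firstB a₁ a₂ a₄ b₄)) :
    ((a₄ - 1).toNat ! : ℤ) * ((a₂ - 1).toNat ! : ℤ) *
        ∑ n ∈ range ((b₄ - a₄ - 1).toNat + 1),
          nearlyPoisedTerm a₄ (a₄ - a₁ + 1) (a₄ - a₁ - a₂ + 1) (a₄ - a₃ + 1) (b₄ - a₄ - 1).toNat n =
      (-1) ^ ((a₁ - 1).toNat + (a₁ + a₂ - a₄ - 1).toNat + (a₂ + a₃ - a₄ - 1).toNat) *
        (((b₄ - a₁ - 1).toNat ! : ℤ) * ((b₄ - a₂ - 1).toNat ! : ℤ) * ((b₄ - a₃ - 1).toNat ! : ℤ) *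
          ((a₁ + a₂ - a₄ - 1).toNat ! : ℤ) * ((a₂ + a₃ - a₄ - 1).toNat ! : ℤ)) *
        ∑ k ∈ Ico (amax (firstA a₁ a₂ a₃ a₄)) b₄, coefCZ (firstA a₁ a₂ a₃ a₄) (firstB a₁ a₂ a₄ b₄) k := by
  obtain ⟨l00, l01, l02, l03, hE, hE', u0, u1, u2, u3, -⟩ := bounds hadm
  have hamax : amax (firstA a₁ a₂ a₃ a₄) = max (max a₁ a₂) (max a₃ a₄) := by
    simp only [amax, TwoTaleWhipple.firstA_zero, TwoTaleWhipple.firstA_one, TwoTaleWhipple.firstA_two,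
      TwoTaleWhipple.firstA_three]
  rw [hamax, sum_range_eq_sum_Ico u3, Finset.mul_sum, Finset.mul_sum,
    sum_Ico_split _ (show a₄ ≤ max (max a₁ a₂) (max a₃ a₄) by omega) (show max (max a₁ a₂) (max a₃ a₄) ≤ b₄ by omega)]
  -- below `max aᵢ` every term vanishes
  have hzero : ∑ k ∈ Ico a₄ (max (max a₁ a₂) (max a₃ a₄)), ((a₄ - 1).toNat ! : ℤ) * ((a₂ - 1).toNat ! : ℤ) *
      nearlyPoisedTerm a₄ (a₄ - a₁ + 1) (a₄ - a₁ - a₂ + 1) (a₄ - a₃ + 1) (b₄ - a₄ - 1).toNat (k - a₄).toNat = 0 := by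
    refine Finset.sum_eq_zero fun k hk => ?_
    rw [Finset.mem_Ico] at hk
    by_cases h1 : k < a₁
    · rw [npt_eq_zero_of_h _ _ _ _ _ _ (by omega) (by omega) (by omega), mul_zero]
    by_cases h2 : k < a₂
    · rw [npt_eq_zero_of_mid _ _ _ _ _ _ (by omega) (by omega) (by omega), mul_zero]
    by_cases h3 : k < a₃
    · rw [npt_eq_zero_of_g _ _ _ _ _ _ (by omega) (by omega) (by omega), mul_zero]
    exfalso; omega
  rw [hzero, zero_add]
  refine Finset.sum_congr rfl fun k hk => ?_
  rw [Finset.mem_Ico] at hk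
  exact first_term hadm (by omega) (by omega) (by omega) (by omega) hk.2

/-- **Second tale summed**: `(a₄−1)!(a₂−1)! · Σ_r saalschutzianTerm = (−1)^N·F·(−1)^{σ₀}·Σ_{k} A_k` over the
double-pole range `[â₃*, b̂₂*)` of the partner, `σ₀ = (b₄−a₃−1) + e' + (a₁+a₄)`. -/
theorem sum_second (hadm : Admissible (firstA a₁ a₂ a₃ a₄) (firstB a₁ a₂ a₄ b₄)) :
    ((a₄ - 1).toNat ! : ℤ) * ((a₂ - 1).toNat ! : ℤ) *
        ∑ n ∈ range ((b₄ - a₄ - 1).toNat + 1),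
          saalschutzianTerm a₄ (a₄ - a₁ + 1) (a₄ - a₁ - a₂ + 1) (a₄ - a₃ + 1) (b₄ - a₄ - 1).toNat n =
      (-1) ^ (b₄ - a₄ - 1).toNat *
        (((b₄ - a₁ - 1).toNat ! : ℤ) * ((b₄ - a₂ - 1).toNat ! : ℤ) * ((b₄ - a₃ - 1).toNat ! : ℤ) *
          ((a₁ + a₂ - a₄ - 1).toNat ! : ℤ) * ((a₂ + a₃ - a₄ - 1).toNat ! : ℤ)) *
        ((-1) ^ ((b₄ - a₃ - 1).toNat + (a₂ + a₃ - a₄ - 1).toNat + (a₁ + a₄).toNat) *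
          ∑ k ∈ Ico (aMax3 (hatA a₁ a₂ a₃ a₄ b₄)) (bMin (hatB a₁ a₂ a₃ a₄ b₄)),
            coefATZ (hatA a₁ a₂ a₃ a₄ b₄) (hatB a₁ a₂ a₃ a₄ b₄) k) := by
  obtain ⟨l00, l01, l02, l03, hE, hE', u0, u1, u2, u3, -⟩ := bounds hadm
  have hamax : aMax3 (hatA a₁ a₂ a₃ a₄ b₄) = max a₂ (max a₁ a₄) := by
    simp only [aMax3, TwoTaleWhipple.hatA_one, TwoTaleWhipple.hatA_two, TwoTaleWhipple.hatA_three]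
  have hbmin : bMin (hatB a₁ a₂ a₃ a₄ b₄) = min (a₁ + a₂) b₄ := by
    simp only [bMin, TwoTaleWhipple.hatB_two, TwoTaleWhipple.hatB_three]
  rw [hamax, hbmin, sum_range_eq_sum_Ico u3, Finset.mul_sum, Finset.mul_sum, Finset.mul_sum,
    sum_Ico_split _ (show a₄ ≤ max a₂ (max a₁ a₄) by omega) (show max a₂ (max a₁ a₄) ≤ b₄ by omega),
    sum_Ico_split _ (show max a₂ (max a₁ a₄) ≤ min (a₁ + a₂) b₄ by omega) (show min (a₁ + a₂) b₄ ≤ b₄ by omega)]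
  have hlow : ∑ k ∈ Ico a₄ (max a₂ (max a₁ a₄)), ((a₄ - 1).toNat ! : ℤ) * ((a₂ - 1).toNat ! : ℤ) *
      saalschutzianTerm a₄ (a₄ - a₁ + 1) (a₄ - a₁ - a₂ + 1) (a₄ - a₃ + 1) (b₄ - a₄ - 1).toNat (k - a₄).toNat = 0 := by
    refine Finset.sum_eq_zero fun k hk => ?_
    rw [Finset.mem_Ico] at hk
    by_cases h1 : k < a₁
    · rw [st_eq_zero_of_h _ _ _ _ _ _ (by omega) (by omega) (by omega), mul_zero]
    by_cases h2 : k < a₂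
    · rw [st_eq_zero_of_mid _ _ _ _ _ _ (by omega) (by omega) (by omega), mul_zero]
    exfalso; omega
  have hhigh : ∑ k ∈ Ico (min (a₁ + a₂) b₄) b₄, ((a₄ - 1).toNat ! : ℤ) * ((a₂ - 1).toNat ! : ℤ) *
      saalschutzianTerm a₄ (a₄ - a₁ + 1) (a₄ - a₁ - a₂ + 1) (a₄ - a₃ + 1) (b₄ - a₄ - 1).toNat (k - a₄).toNat = 0 := by
    refine Finset.sum_eq_zero fun k hk => ?_
    rw [Finset.mem_Ico] at hk
    rw [st_eq_zero_of_a _ _ _ _ _ _ (by omega) (by omega), mul_zero]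
  rw [hlow, zero_add, hhigh, add_zero]
  refine Finset.sum_congr rfl fun k hk => ?_
  rw [Finset.mem_Ico] at hk
  by_cases hg : 2 * k < b₄ - a₃ + a₄
  · -- the guard: `A_k = 0` and the Saalschützian term vanishes through `(−t)_m`
    have hA0 : coefATZ (hatA a₁ a₂ a₃ a₄ b₄) (hatB a₁ a₂ a₃ a₄ b₄) k = 0 := by
      unfold coefATZ; rw [if_pos (by simpa using hg)]
    rw [hA0, mul_zero, mul_zero,
      st_eq_zero_of_g _ _ _ _ _ _ (by omega) (by omega) (by omega), mul_zero]
  · rw [second_term hadm (by omega) (by omega) (by omega) (by omega) (by omega) hg,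
      SorokinCensus.neg_one_pow_eq_of_mod_two_eq
        (m := (b₄ - a₃ - 1).toNat + (a₂ + a₃ - a₄ - 1).toNat + (k - a₁).toNat + (k - a₄).toNat)
        (n := (b₄ - a₃ - 1).toNat + (a₂ + a₃ - a₄ - 1).toNat + (a₁ + a₄).toNat) (by omega)]

end sums

/-! ### Remark 5 for all admissible data -/

section main

open Literature.NumberTheory.Irrationality.Zudilin2014
open Summit.KontsevichZagierPeriods.Zeta5Search.TwoTaleWhipple (firstA firstB hatA hatB WhippleRemark5)

/-- **Zudilin's Remark 5 for ALL admissible Remark-5 data** [cite: Zudilin2014ZetaTwo, Remark 5; Slater1966,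
(2.4.2.3); Whipple 1926, §3.5]: `q(a₁,a₂,a₃,a₄; 1, a₄−a₁+1, a₄−a₂+1, b₄) = −q̂(b₄−a₃+a₄; a₂, a₁, a₄; a₄+1; a₄−a₃+1, a₁+a₂, b₄)`
for the Literature's integer mirrors `formQZ` / `formQTZ`, with NO cone hypothesis (the tree's `remark5Max` is the
case `a₁, a₂, a₃ ≤ a₄`). Proof: the k-centric dictionary `sum_first` / `sum_second`, Whipple's transformation (W)
over `ℤ` (`HypergeometricWhipple.whipple_nearlyPoised_terms`), cancellation of the non-zero factorial factor and a
parity count. -/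
theorem remark5 (a₁ a₂ a₃ a₄ b₄ : ℤ) (hadm : Admissible (firstA a₁ a₂ a₃ a₄) (firstB a₁ a₂ a₄ b₄)) :
    formQZ (firstA a₁ a₂ a₃ a₄) (firstB a₁ a₂ a₄ b₄) = -formQTZ (hatA a₁ a₂ a₃ a₄ b₄) (hatB a₁ a₂ a₃ a₄ b₄) := by
  obtain ⟨l00, l01, l02, l03, hE, hE', u0, u1, u2, u3, hbal⟩ := bounds hadm
  have W := whipple_nearlyPoised_terms (R := ℤ) a₄ (a₄ - a₁ + 1) (a₄ - a₁ - a₂ + 1) (a₄ - a₃ + 1)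
    (b₄ - a₄ - 1).toNat
  have S1 := sum_first hadm
  have S2 := sum_second hadm
  rw [W] at S1
  have E := S1.symm.trans S2
  -- the two integer mirrors as signed pole sums
  have hd : dExp (firstA a₁ a₂ a₃ a₄) (firstB a₁ a₂ a₄ b₄) = (2 * a₁ + 2 * a₂ + a₃ - a₄ - 3 - b₄).toNat := by
    simp only [dExp, TwoTaleWhipple.firstA_zero, TwoTaleWhipple.firstA_one, TwoTaleWhipple.firstA_two,
      TwoTaleWhipple.firstA_three, TwoTaleWhipple.firstB_zero, TwoTaleWhipple.firstB_one,
      TwoTaleWhipple.firstB_two, TwoTaleWhipple.firstB_three, Fin.sum_univ_four]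
    congr 1; ring
  have hC : ∑ k ∈ Ico (amax (firstA a₁ a₂ a₃ a₄)) b₄, coefCZ (firstA a₁ a₂ a₃ a₄) (firstB a₁ a₂ a₄ b₄) k =
      (-1) ^ (2 * a₁ + 2 * a₂ + a₃ - a₄ - 3 - b₄).toNat * formQZ (firstA a₁ a₂ a₃ a₄) (firstB a₁ a₂ a₄ b₄) := by
    unfold formQZ
    rw [hd, TwoTaleWhipple.firstB_three, ← mul_assoc, ← pow_add, ← two_mul, pow_mul, neg_one_sq, one_pow,
      one_mul]
  have hA : ∑ k ∈ Ico (aMax3 (hatA a₁ a₂ a₃ a₄ b₄)) (bMin (hatB a₁ a₂ a₃ a₄ b₄)),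
        coefATZ (hatA a₁ a₂ a₃ a₄ b₄) (hatB a₁ a₂ a₃ a₄ b₄) k =
      (-1) ^ (a₁ + a₂ + b₄).natAbs * formQTZ (hatA a₁ a₂ a₃ a₄ b₄) (hatB a₁ a₂ a₃ a₄ b₄) := by
    unfold formQTZ
    rw [TwoTaleWhipple.hatB_two, TwoTaleWhipple.hatB_three, ← mul_assoc, ← pow_add, ← two_mul, pow_mul,
      neg_one_sq, one_pow, one_mul]
  rw [hC, hA] at E
  -- parity of the signs
  have ht : (((a₁ + a₂ + b₄).natAbs : ℕ) : ℤ) = a₁ + a₂ + b₄ := Int.natAbs_of_nonneg (by omega)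
  have hmod : ((a₁ - 1).toNat + (a₁ + a₂ - a₄ - 1).toNat + (a₂ + a₃ - a₄ - 1).toNat +
        (2 * a₁ + 2 * a₂ + a₃ - a₄ - 3 - b₄).toNat) % 2 =
      ((b₄ - a₄ - 1).toNat + ((b₄ - a₃ - 1).toNat + (a₂ + a₃ - a₄ - 1).toNat + (a₁ + a₄).toNat +
        (a₁ + a₂ + b₄).natAbs) + 1) % 2 := by
    have e1 : (((a₁ - 1).toNat : ℕ) : ℤ) = a₁ - 1 := by omega
    have e2 : (((a₁ + a₂ - a₄ - 1).toNat : ℕ) : ℤ) = a₁ + a₂ - a₄ - 1 := by omega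
    have e3 : (((a₂ + a₃ - a₄ - 1).toNat : ℕ) : ℤ) = a₂ + a₃ - a₄ - 1 := by omega
    have e4 : (((2 * a₁ + 2 * a₂ + a₃ - a₄ - 3 - b₄).toNat : ℕ) : ℤ) = 2 * a₁ + 2 * a₂ + a₃ - a₄ - 3 - b₄ := by
      omega
    have e5 : (((b₄ - a₄ - 1).toNat : ℕ) : ℤ) = b₄ - a₄ - 1 := by omega
    have e6 : (((b₄ - a₃ - 1).toNat : ℕ) : ℤ) = b₄ - a₃ - 1 := by omega
    have e7 : (((a₁ + a₄).toNat : ℕ) : ℤ) = a₁ + a₄ := by omega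
    generalize (a₁ - 1).toNat = A1 at e1 ⊢
    generalize (a₁ + a₂ - a₄ - 1).toNat = E at e2 ⊢
    generalize (a₂ + a₃ - a₄ - 1).toNat = E' at e3 ⊢
    generalize (2 * a₁ + 2 * a₂ + a₃ - a₄ - 3 - b₄).toNat = D at e4 ⊢
    generalize (b₄ - a₄ - 1).toNat = N at e5 ⊢
    generalize (b₄ - a₃ - 1).toNat = B at e6 ⊢
    generalize (a₁ + a₄).toNat = S at e7 ⊢
    generalize (a₁ + a₂ + b₄).natAbs = T at ht ⊢
    omega
  have hpar : (-1 : ℤ) ^ ((a₁ - 1).toNat + (a₁ + a₂ - a₄ - 1).toNat + (a₂ + a₃ - a₄ - 1).toNat) *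
      (-1) ^ (2 * a₁ + 2 * a₂ + a₃ - a₄ - 3 - b₄).toNat =
      -((-1) ^ (b₄ - a₄ - 1).toNat * ((-1) ^ ((b₄ - a₃ - 1).toNat + (a₂ + a₃ - a₄ - 1).toNat + (a₁ + a₄).toNat) *
        (-1) ^ (a₁ + a₂ + b₄).natAbs)) := by
    rw [← pow_add, ← pow_add, ← pow_add, SorokinCensus.neg_one_pow_eq_of_mod_two_eq hmod, pow_succ, mul_neg_one]
  rw [show ∀ (x y F q : ℤ), x * F * (y * q) = (x * y) * F * q from fun x y F q => by ring, hpar] at E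
  -- cancel the non-zero common factor
  have hF : ((b₄ - a₁ - 1).toNat ! : ℤ) * ((b₄ - a₂ - 1).toNat ! : ℤ) * ((b₄ - a₃ - 1).toNat ! : ℤ) *
      ((a₁ + a₂ - a₄ - 1).toNat ! : ℤ) * ((a₂ + a₃ - a₄ - 1).toNat ! : ℤ) ≠ 0 := by positivity
  have hR : (-1 : ℤ) ^ (b₄ - a₄ - 1).toNat * ((-1) ^ ((b₄ - a₃ - 1).toNat + (a₂ + a₃ - a₄ - 1).toNat +
      (a₁ + a₄).toNat) * (-1) ^ (a₁ + a₂ + b₄).natAbs) ≠ 0 :=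
    mul_ne_zero (pow_ne_zero _ (by norm_num)) (mul_ne_zero (pow_ne_zero _ (by norm_num)) (pow_ne_zero _ (by norm_num)))
  have key : (((b₄ - a₁ - 1).toNat ! : ℤ) * ((b₄ - a₂ - 1).toNat ! : ℤ) * ((b₄ - a₃ - 1).toNat ! : ℤ) *
      ((a₁ + a₂ - a₄ - 1).toNat ! : ℤ) * ((a₂ + a₃ - a₄ - 1).toNat ! : ℤ)) *
      (((-1 : ℤ) ^ (b₄ - a₄ - 1).toNat * ((-1) ^ ((b₄ - a₃ - 1).toNat + (a₂ + a₃ - a₄ - 1).toNat +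
        (a₁ + a₄).toNat) * (-1) ^ (a₁ + a₂ + b₄).natAbs)) *
        (formQZ (firstA a₁ a₂ a₃ a₄) (firstB a₁ a₂ a₄ b₄) + formQTZ (hatA a₁ a₂ a₃ a₄ b₄) (hatB a₁ a₂ a₃ a₄ b₄))) = 0 := by
    linear_combination (-1 : ℤ) * E
  rcases mul_eq_zero.1 key with h0 | h1
  · exact absurd h0 hF
  rcases mul_eq_zero.1 h1 with h2 | h3
  · exact absurd h2 hR
  linarith

/-- **The named input `WhippleRemark5` of the two-tale files HOLDS** (the `@[conjecture]` node
`TwoTaleWhipple.WhippleRemark5`, binders in `TwoTaleWhipple`, `TwoTaleWhippleP15`, `TwoTaleWhippleMeasures`):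
Zudilin 2014, Remark 5 for every first-tale-admissible Remark-5 datum. [cite: Zudilin2014ZetaTwo, Remark 5] -/
theorem whippleRemark5_holds : WhippleRemark5 := fun a₁ a₂ a₃ a₄ b₄ hadm => remark5 a₁ a₂ a₃ a₄ b₄ hadm

end main

end Summit.KontsevichZagierPeriods.Zeta5Search.TwoTaleWhippleRemark5Full
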